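import Literature.NumberTheory.LFunctions.MertensSecondUpperChain
import HarnessLib

/-!
# RH-FREE kernel certificate — «nothing here bears on the truth of RH»
# Rosser–Schoenfeld's (3.18) below `3 659 203`: certified run, chunks 11–15

Topic: `Literature/NumberTheory/LFunctions`. Pure proof file (kernel computation; nothing is asserted, no
definition). Each `runK` evaluates `MertensSecondUpperChain.runD 15333` — `15333` steps of the upper chain of
`MertensSecondUpperChain.lean` along the prime table `ChainTable.table`, each certifying the primality of the next
entry `p'`, performing the comparison `cmp` for the old state (which gives
`Σ_{q ≤ x} 1/q < log log x + B + 1/(2 log² x)` on `[p, p') ∩ [286, ∞)`), and extending the enclosure of `log p'`,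
the lower bound of `log log p'` and the upper bound of the sum. This file: primes `2063741 → 3196909`. The four files
`MertensSecondUpperChainRun1–4.lean` (chunks 1–17, primes `3 → 3659203`) cover Rosser–Schoenfeld's tabular range of
(3.18) up to Dusart's analytic threshold `3 594 641` (assembly: `MertensSecondUpperErrorBound.lean`). The expected
states were obtained by evaluating the same function compiled (`#eval` on the Lean farm, 2026-08-28; all 17
comparisons pass). `decide +kernel`, standard axioms only (`maxHeartbeats 0`; ≈ 30 s of kernel time per chunk).

## References
* J. B. Rosser, L. Schoenfeld, Illinois J. Math. 6 (1962), 64–94: Thm 5 (3.18), p. 70; Thm 20 and §8 p. 87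
  (the tabular range). [RosserSchoenfeld1962]
-/

namespace Literature.NumberTheory.LFunctions.MertensSecondUpperChainRun

open MertensSecondUpperChain

set_option maxHeartbeats 0 in
/-- **Chunk 11 of the certified upper run** (primes `2063741` to `2287613`).
[cite: RosserSchoenfeld1962, Thm. 5 (3.18) and Thm. 20 (tabular range)] -/
theorem run11 :
    runD 15333
      ⟨2063741, 17577818788978594365443835, 17577818788979069975295767,
        3236180288846491774256043, 3552377519997539625385999⟩ =
    some ⟨2287613, 17702324319019170480344994, 17702324319019646090559893,
        3244713052760767151802450, 3560905236516466680794208⟩ := by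
  decide +kernel

set_option maxHeartbeats 0 in
/-- **Chunk 12 of the certified upper run** (primes `2287613` to `2513557`).
[cite: RosserSchoenfeld1962, Thm. 5 (3.18) and Thm. 20 (tabular range)] -/
theorem run12 :
    runD 15333
      ⟨2287613, 17702324319019170480344994, 17702324319019646090559893,
        3244713052760767151802450, 3560905236516466680794208⟩ =
    some ⟨2513557, 17816193000357543749034675, 17816193000358019359612176,
        3252464460313808483947093, 3568632368515948024297114⟩ := by
  decide +kernel

set_option maxHeartbeats 0 in
/-- **Chunk 13 of the certified upper run** (primes `2513557` to `2740141`).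
[cite: RosserSchoenfeld1962, Thm. 5 (3.18) and Thm. 20 (tabular range)] -/
theorem run13 :
    runD 15333
      ⟨2513557, 17816193000357543749034675, 17816193000358019359612176,
        3252464460313808483947093, 3568632368515948024297114⟩ =
    some ⟨2740141, 17920535989283446663496891, 17920535989283922274436404,
        3259524047837284216728794, 3575693924440105969310236⟩ := by
  decide +kernel

set_option maxHeartbeats 0 in
/-- **Chunk 14 of the certified upper run** (primes `2740141` to `2968027`).
[cite: RosserSchoenfeld1962, Thm. 5 (3.18) and Thm. 20 (tabular range)] -/
theorem run14 :
    runD 15333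
      ⟨2740141, 17920535989283446663496891, 17920535989283922274436404,
        3259524047837284216728794, 3575693924440105969310236⟩ =
    some ⟨2968027, 18017114707590501689633511, 18017114707590977300935016,
        3266021789129976186425405, 3582192847133488606722892⟩ := by
  decide +kernel

set_option maxHeartbeats 0 in
/-- **Chunk 15 of the certified upper run** (primes `2968027` to `3196909`).
[cite: RosserSchoenfeld1962, Thm. 5 (3.18) and Thm. 20 (tabular range)] -/
theorem run15 :
    runD 15333
      ⟨2968027, 18017114707590501689633511, 18017114707590977300935016,
        3266021789129976186425405, 3582192847133488606722892⟩ =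
    some ⟨3196909, 18106922159628504133144670, 18106922159628979744800957,
        3272032787448044143646235, 3588208884519798758539562⟩ := by
  decide +kernel

end Literature.NumberTheory.LFunctions.MertensSecondUpperChainRun
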